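/-
Copyright (c) 2026 the pub-hodgecm-mathlib formalisation cell (harness21).  Prover seat hodgecm-mathlib-LH7-p10 (g0), req620 Track A «(D-RAM) FOUR-FRAME» squad
(STAGE-1b, row (2) of the piece `f_{T₊}`, the (β₂) road (R-36) «PURE-CELL LEDGER» ∕ T20-19 «RELATIVE SIGNS»: heir LEAD F0P3a-plan (g21); β₂ sub-dealer LH4-p04 (g8)
`BETA2-BOARD.v1` da0f832c; refuter LH4-cdis1 (g0) `BETA2-CELLCHECK.v1` cf94291e + 15:28:14Z (L1)–(L4); sequel of ★ p861334 `F0P3cDyRamConeCellDiagonalSize`), 2026-09-04.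
-/
import Summits.HodgeConjecture.HodgeConjecture.Theorems.F0P3cDyRamConeCellDiagonalSize   -- ★ p861334 (this seat): the diagonal cell; brings ★ T5a Dep-reduction, ★ T5b∕T5a tables at the frame, ★ cone weight, ★ DEFS
import HarnessLib

/-!
# Crux `H413`, line LH4 «(D-RAM) FOUR-FRAME» — STAGE-1b, row (2), the (β₂) road (R-36)∕T20-19, THE SIZES OF THE PURE-CELL LEDGER:
# «every ledger cell `(j, a) = (a + c, a)`, `2a ≤ m`, is the WHOLE u-free level set when `c ≤ δ` and EMPTY beyond; its count is the ★ T5b row at `c` —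
#  BOUNDARY `c + 2 = 2d`: `(q−2)q^{j−d}` ∕ `q^{j−d+1}`, FAR `c + 2 > 2d`: `2(q−1)q^{j−1−c∕2}` ∕ `0`, NEAR `c + 2 < 2d`: `(q−1)q^{j−1−c∕2}` (hyperbolic ∕ anisotropic literal)»

Cell `hodgecm-mathlib` (D-0151), FLOOR 0, crux item H413 = `stmt-HodgeConjecture-24833`, route of record `HCCMUnconditional`; squad F0∕P3c∕LH4; lane
`--supports stmt-HodgeConjecture-24833 --as helper` (count-neutral; pays NO tier-0 row).  THEOREMS ONLY (no `def`, no instance, no notation, no `sorry`, default heartbeats);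
★-only imports; states NO law; (β₂) stays a HYPOTHESIS.

WHY (heir LEAD T20-19 (ρ-a)…(ρ-d); LH4-cdis1 (g0) 15:28:14Z (L3)(L4); F0P3-p01 (g36) «PURE-CELL LEDGER v1» 86ca30c7).  Read RELATIVELY, the (β₂) letter at the U-keys is an identity
between the signed labelled counts of a handful of PURE cone cells of the two literals: the diagonal cell `D = (a, a)` (`a = m∕2`, `m = v(lam − jE u₀₀)`; ★ p861334: `q^a`
plane lattices, weighted size `q^m` on BOTH literals), lit₁'s SPECIFIC cell `S₁ = (a + 2, a)` (`|S₁| = 2|D|` at q = d = 2) and lit₂'s TOWER `T_c = (a + c, a)`, `c = 4, 6, …`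
(`|T_c| = 2^{c∕2}·|D|`); every size the refuter reads is «THE WHOLE CELL AT FULL WEIGHT».  THIS FILE types the q-general census behind those sizes, from ★ bricks only, so that
the producers of the maps (T20-19: `S₁ → D` 2 : 1, the tail's Hensel doublings) and the (L-Σ) arithmetic have the counts BY NAME:
* §1 (one-field M-letters, `M∕E` unramified: `ρϖE = ϖE`) — ON THE LOW CELLS THE DEPTH CONDITION IS u-FREE: for `1 ≤ a`, `2a ≤ m`:
  `levelSetDep(j, a; μ) = levelSet(j, a)` when `j + a ≤ jλ` (`levelSetDep_eq_levelSet_of_add_le`; ★ T5a (R1-OFF) clause `j + a ≤ jλ`, or (R1-DIAG-LOW) at `j + m = jλ + a`),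
  and `levelSetDep(j, a; μ) = ∅` when `m < j + a` and `jλ < j + a` (`levelSetDep_eq_empty_of_lt_add`).  At `a = m∕2`, `j = a + c`: «whole cell for `c ≤ δ := jλ − m`, empty
  beyond» — the tower STOPS at `c = δ` (cdis1 (L4): pure cells up to `c = δ − 2`; the `c = δ` cell is populated and belongs to (ρ-d)).
* §2 (type RamK, the lane of the U-keys; ★ T5b at the frame p857929, third field discharged) — THE THREE ROW READERS, binder-light, either literal by name:
  BOUNDARY `j + 2 = a + 2d` (`a ≥ 1`, `d ≥ 2`): hyperbolic `(q−2)·q^{j−d}` (`ncard_levelSet_boundary_ramK_hyper`) — ZERO at `q = 2` ONLY —, anisotropic `q^{j−d+1}`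
  (`…_aniso`); FAR `a + 2d ≤ j`, `j ≡ a (2)`: hyperbolic `2(q−1)·q^{j−1−(j−a)∕2}`, anisotropic `0`; NEAR `a + 2 ≤ j`, `j + 2 < a + 2d`, `j ≡ a (2)`: `(q−1)·q^{j−1−(j−a)∕2}` on
  both.  (At q = d = 2, `a = m∕2`: `S₁ = (a+2, a)` is the boundary row — anisotropic `q^{a+1}` lattices × weight `q^a` = `2^{ρ₁₃+1}` ✓, hyperbolic `0` ✓; `T_c = (a+c, a)`,
  `c ≥ 4`, are far rows — hyperbolic `2·q^{a+c∕2−1}` lattices × `q^a` = `2^{ρ₁₃}·2^{c∕2}` ✓ (64, 128 at key (12,4)), anisotropic `0` ✓ — cdis1 (L3)(L4) to the digit.)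
* §3 the `levelSetDep` forms with the tokens `|μ| = exp(−m)`, `|μ − ρμ| = exp(−jλ)` (§1 ⊕ §2): `ncard_levelSetDep_boundary_ramK_hyper∕aniso`, `…_far_…`, `…_near_ramK`.
* §4 (the (β) cone frame of ★ p857697, two fields) `finsum_levelSetDep_weight_eq_pow_mul_ncard_levelSet_of_add_le` — WEIGHTED SIZE OF A LOW CELL: `Σᶠ_{Λ ∈ levelSetDep(j, a; lam − jE u)}
  f a j Λ = q_E^a · #levelSet(j, a)` (★ cone weight `q_E^a · #cell` ⊕ §1); consumers rewrite `#levelSet(j, a)` with §2 in their lane.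
Q > 2 FLAG (numbers, not adjectives; posted to the board 15:3xZ): the hyperbolic boundary cell carries `(q−2)·q^{j−d}` lattices — empty at every engine key (F = ℚ₂, q = 2),
populated for `q ≥ 4`; its label behaviour is untested, so the relative grammar «lit₁ = {D, S₁} vs lit₂ = {D, tail}» is q = 2-shaped as evidence (the census here is q-general).
NOT CLAIMED: purity ∕ coverage ∕ signs of any cell (LH4-p15, LH4-p16, LH4-p09, cdis1 rows), the maps of T20-19, (L-Σ).
HONEST LABEL.  Count-neutral index bookkeeping over ★ tables; nothing printed is asserted; no census law is stated; (β₂) the LETTER is witness-true (17 + 36 + 34 rows) and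
UNPROVED; `HC_CM` is proved only modulo the 7 printed citations (2 remaining named inputs: hLiu418 = `stmt-HodgeConjecture-24832`, h413 = `stmt-HodgeConjecture-24833`) until
rung 0 closes.
## References
* [Flicker1998UnitaryFL] Y. Z. Flicker, *Elementary proof of the fundamental lemma for a unitary group*, Canad. J. Math. 50 (1998), Prop. 7 p. 84 (torus-orbit census on the tree).
* [Kottwitz1986BaseChangeUnits] R. E. Kottwitz, *Base change for unit elements of Hecke algebras*, Compositio Math. 60 (1986), §1 pp. 240–241 (fixed-lattice counts as orbital integrals).
* [Jacobowitz1962] R. Jacobowitz, *Hermitian forms over local fields*, Amer. J. Math. 84 (1962), §4 (dual lattices, modular components, gluing).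
* [Serre1979] J.-P. Serre, *Local Fields*, GTM 67 (1979), Ch. V §3 Prop. 5, Cor. 2–3 pp. 84–86 (norm indices of a ramified quadratic extension).
* [Rogawski1990] J. D. Rogawski, *Automorphic Representations of Unitary Groups in Three Variables*, Ann. of Math. Stud. 123 (1990), §4.9 Prop. 4.9.1 (b) p. 55 (the labelled census of `f_{T₊}`).
-/

set_option autoImplicit false

noncomputable section

open scoped Valued WithZero Matrix MatrixGroups
open WithZero
open scoped Classical
open Literature.NumberTheory.Automorphic Literature.NumberTheory.Automorphic.HermitianLattice Literature.NumberTheory.Automorphic.UnitaryLatticeTree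
open Literature.NumberTheory.Automorphic.UnitaryThreeFourFrame (IsRamifiedQuadraticDatum)
open Summit.HodgeConjecture.HodgeConjecture.Cruxes.H413.F0P3cDyRamToricCensusDefs
open Summit.HodgeConjecture.HodgeConjecture.Cruxes.H413.F0P3cDyRamToricLevelCensusUnr (levelSetDep_eq_of_offDiag levelSetDep_eq_of_diag_low)
open Summit.HodgeConjecture.HodgeConjecture.Cruxes.H413.F0P3cDyRamToricLevelCensusRamKAtThirdField (ncard_levelSet_ramK_hyper_of_frame ncard_levelSet_ramK_aniso_of_frame)
open Summit.HodgeConjecture.HodgeConjecture.Cruxes.H413.F0P3cDyRamConeWeightHalfSplit (finsum_levelSetDep_weight_eq_pow_mul_ncard)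

namespace Summit.HodgeConjecture.HodgeConjecture.Cruxes.H413.F0P3cDyRamConeCellLedgerSizes

/-! ## §1 On the low cells (`2a ≤ m`) the depth condition is u-free: the whole level set for `j + a ≤ jλ`, empty beyond -/

section Depth

variable {K : Type*} [Field K] [Valued K ℤᵐ⁰] {ρ Θ : K →+* K} {α ϖE h : K}

/-- **LOW CELLS PASS THE DEPTH CONDITION WHOLE.**  In the one-field frame of ★ T5a (`ρ` an isometric involution commuting with the isometric involution `Θ`, `|α − ρα| = 1`,
`ρϖE = ϖE`, `|ϖE| = exp(−1)`, `h ≠ 0`), for a token `μ` with `|μ| = exp(−m)`, `|μ − ρμ| = exp(−jλ)`, a tube depth `a ≥ 1` with `2a ≤ m` and a level `j` with `j + a ≤ jλ`: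
`levelSetDep ρ Θ α ϖE h j a μ = levelSet ρ Θ α ϖE h j a` (★ (R1-OFF), clause `j + a ≤ jλ`; ★ (R1-DIAG-LOW) when `j + m = jλ + a`).  At `a = m∕2`, `j = a + c` this is «the whole cell for
`c ≤ δ = jλ − m`». [cite: Jacobowitz1962, §4] [cite: Kottwitz1986BaseChangeUnits, §1 pp. 240–241] -/
theorem levelSetDep_eq_levelSet_of_add_le (hρρ : ∀ x, ρ (ρ x) = x) (hvρ : ∀ x, Valued.v (ρ x) = Valued.v x) (hΘΘ : ∀ x, Θ (Θ x) = x)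
    (hΘρ : ∀ x, Θ (ρ x) = ρ (Θ x)) (hvΘ : ∀ x, Valued.v (Θ x) = Valued.v x) (hα1 : Valued.v α ≤ 1) (hα : Valued.v (α - ρ α) = 1)
    (hρϖE : ρ ϖE = ϖE) (hϖE : Valued.v ϖE = exp (-1 : ℤ)) (hh : h ≠ 0)
    {μ : K} {m jl : ℕ} (hm : Valued.v μ = exp (-(m : ℤ))) (hjl : Valued.v (μ - ρ μ) = exp (-(jl : ℤ)))
    {j a : ℕ} (ha : 1 ≤ a) (h2a : 2 * a ≤ m) (hja : j + a ≤ jl) :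
    levelSetDep ρ Θ α ϖE h j a μ = levelSet ρ Θ α ϖE h j a := by
  by_cases hdiag : j + m = jl + a
  · exact levelSetDep_eq_of_diag_low hρρ hvρ hΘΘ hΘρ hvΘ hα1 hα hρϖE hϖE hh hm hjl ha hdiag h2a
  · rw [levelSetDep_eq_of_offDiag hρρ hvρ hΘΘ hΘρ hvΘ hα1 hα hρϖE hϖE hh hm hjl ha hdiag, if_pos ⟨h2a, Or.inr hja⟩]

/-- **BEYOND `jλ` (AND `m`) A LOW CELL IS EMPTY**: `1 ≤ a`, `2a ≤ m`, `m < j + a`, `jλ < j + a` ⇒ `levelSetDep ρ Θ α ϖE h j a μ = ∅` (off the diagonal automatically, and the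
★ (R1-OFF) clause fails).  At `a = m∕2`, `j = a + c`: «no cell for `c > δ`» — the lit₂ tower stops at `c = δ`. [cite: Jacobowitz1962, §4] [cite: Kottwitz1986BaseChangeUnits, §1 pp. 240–241] -/
theorem levelSetDep_eq_empty_of_lt_add (hρρ : ∀ x, ρ (ρ x) = x) (hvρ : ∀ x, Valued.v (ρ x) = Valued.v x) (hΘΘ : ∀ x, Θ (Θ x) = x)
    (hΘρ : ∀ x, Θ (ρ x) = ρ (Θ x)) (hvΘ : ∀ x, Valued.v (Θ x) = Valued.v x) (hα1 : Valued.v α ≤ 1) (hα : Valued.v (α - ρ α) = 1)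
    (hρϖE : ρ ϖE = ϖE) (hϖE : Valued.v ϖE = exp (-1 : ℤ)) (hh : h ≠ 0)
    {μ : K} {m jl : ℕ} (hm : Valued.v μ = exp (-(m : ℤ))) (hjl : Valued.v (μ - ρ μ) = exp (-(jl : ℤ)))
    {j a : ℕ} (ha : 1 ≤ a) (h2a : 2 * a ≤ m) (hmj : m < j + a) (hjlj : jl < j + a) :
    levelSetDep ρ Θ α ϖE h j a μ = ∅ := by
  have hdiag : j + m ≠ jl + a := by omega
  rw [levelSetDep_eq_of_offDiag hρρ hvρ hΘΘ hΘρ hvΘ hα1 hα hρϖE hϖE hh hm hjl ha hdiag, if_neg (by omega)]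

/-- Counted forms: `#levelSetDep(j, a; μ) = #levelSet(j, a)` for `1 ≤ a`, `2a ≤ m`, `j + a ≤ jλ`. [cite: Jacobowitz1962, §4] -/
theorem ncard_levelSetDep_eq_of_add_le (hρρ : ∀ x, ρ (ρ x) = x) (hvρ : ∀ x, Valued.v (ρ x) = Valued.v x) (hΘΘ : ∀ x, Θ (Θ x) = x)
    (hΘρ : ∀ x, Θ (ρ x) = ρ (Θ x)) (hvΘ : ∀ x, Valued.v (Θ x) = Valued.v x) (hα1 : Valued.v α ≤ 1) (hα : Valued.v (α - ρ α) = 1)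
    (hρϖE : ρ ϖE = ϖE) (hϖE : Valued.v ϖE = exp (-1 : ℤ)) (hh : h ≠ 0)
    {μ : K} {m jl : ℕ} (hm : Valued.v μ = exp (-(m : ℤ))) (hjl : Valued.v (μ - ρ μ) = exp (-(jl : ℤ)))
    {j a : ℕ} (ha : 1 ≤ a) (h2a : 2 * a ≤ m) (hja : j + a ≤ jl) :
    (levelSetDep ρ Θ α ϖE h j a μ).ncard = (levelSet ρ Θ α ϖE h j a).ncard := by
  rw [levelSetDep_eq_levelSet_of_add_le hρρ hvρ hΘΘ hΘρ hvΘ hα1 hα hρϖE hϖE hh hm hjl ha h2a hja]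

/-- … and `#levelSetDep(j, a; μ) = 0` for `1 ≤ a`, `2a ≤ m`, `m < j + a`, `jλ < j + a`. [cite: Jacobowitz1962, §4] -/
theorem ncard_levelSetDep_eq_zero_of_lt_add (hρρ : ∀ x, ρ (ρ x) = x) (hvρ : ∀ x, Valued.v (ρ x) = Valued.v x) (hΘΘ : ∀ x, Θ (Θ x) = x)
    (hΘρ : ∀ x, Θ (ρ x) = ρ (Θ x)) (hvΘ : ∀ x, Valued.v (Θ x) = Valued.v x) (hα1 : Valued.v α ≤ 1) (hα : Valued.v (α - ρ α) = 1)
    (hρϖE : ρ ϖE = ϖE) (hϖE : Valued.v ϖE = exp (-1 : ℤ)) (hh : h ≠ 0)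
    {μ : K} {m jl : ℕ} (hm : Valued.v μ = exp (-(m : ℤ))) (hjl : Valued.v (μ - ρ μ) = exp (-(jl : ℤ)))
    {j a : ℕ} (ha : 1 ≤ a) (h2a : 2 * a ≤ m) (hmj : m < j + a) (hjlj : jl < j + a) :
    (levelSetDep ρ Θ α ϖE h j a μ).ncard = 0 := by
  rw [levelSetDep_eq_empty_of_lt_add hρρ hvρ hΘΘ hΘρ hvΘ hα1 hα hρϖE hϖE hh hm hjl ha h2a hmj hjlj, Set.ncard_empty]

end Depth

/-! ## §2 Type RamK, the three u-free row readers at the frame: BOUNDARY `j + 2 = a + 2d`, FAR `a + 2d ≤ j`, NEAR `a + 2 ≤ j < a + 2d − 2` -/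

section RamK

variable {K : Type} [Field K] [Valued K ℤᵐ⁰] {ρ Θ : K →+* K} {α ϖE h : K}

/-- **BOUNDARY ROW, HYPERBOLIC LITERAL, TYPE RamK**: `j + 2 = a + 2d`, `a ≥ 1`, `d ≥ 2` ⇒ `#levelSet(j, a) = (q − 2)·q^{j−d}` — ZERO at `q = 2` only (the refuter's «lit has no S-cell» is
a q = 2 phenomenon).  Frame = ★ p857929's (`hρρ hvρ hΘρ hα1 hα`, the ramified Θ-datum, `ρϖE = ϖE`, `#𝓀[K] = q²`, `hσres`, `hram`), `h` Θ-fixed non-zero ISOTROPIC.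
[cite: Flicker1998UnitaryFL, Prop. 7 p. 84] [cite: Serre1979, Ch. V §3 Prop. 5, Cor. 2–3 pp. 84–86] [cite: Jacobowitz1962, §4] -/
theorem ncard_levelSet_boundary_ramK_hyper [CompleteSpace K] [IsDiscreteValuationRing 𝒪[K]] [Finite 𝓀[K]]
    (hρρ : ∀ x, ρ (ρ x) = x) (hvρ : ∀ x, Valued.v (ρ x) = Valued.v x) (hΘρ : ∀ x, Θ (ρ x) = ρ (Θ x))
    (hα1 : Valued.v α ≤ 1) (hα : Valued.v (α - ρ α) = 1) {d t : ℕ} (hD : IsRamifiedQuadraticDatum Θ ϖE d t) (hρϖ : ρ ϖE = ϖE)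
    (hΘh : Θ h = h) (hh : h ≠ 0) {q : ℕ} (hq : Nat.card 𝓀[K] = q ^ 2)
    (hσres : ∀ z : K, ρ z = z → Valued.v z ≤ 1 → Valued.v (Θ z - z) < 1) (hram : Valued.v (α - Θ α) < 1)
    (hhyper : ∃ x : K, x ≠ 0 ∧ h * Θ x * x + ρ (h * Θ x * x) = 0)
    (hd2 : 2 ≤ d) {j a : ℕ} (ha : 1 ≤ a) (hbdry : j + 2 = a + 2 * d) :
    (levelSet ρ Θ α ϖE h j a).ncard = (q - 2) * q ^ (j - d) := by
  rw [ncard_levelSet_ramK_hyper_of_frame hρρ hvρ hΘρ hα1 hα hD hρϖ hΘh hh hq hσres hram hhyper j a,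
    if_neg (by omega), if_neg (by omega), if_neg (by omega), if_neg (by omega), if_neg (by omega), if_pos (by omega)]

/-- **BOUNDARY ROW, ANISOTROPIC LITERAL, TYPE RamK**: `j + 2 = a + 2d`, `a ≥ 1`, `d ≥ 2` ⇒ `#levelSet(j, a) = q^{j−d+1}` (`h` Θ-fixed non-zero ANISOTROPIC).  At q = d = 2, `a = m∕2`:
the refuter's `S₁ = (a + 2, a)`, `q^{a+1}` lattices × weight `q^a` = `2^{ρ₁₃+1} = 2|D|`. [cite: Flicker1998UnitaryFL, Prop. 7 p. 84] [cite: Serre1979, Ch. V §3 Prop. 5, Cor. 2–3 pp. 84–86] -/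
theorem ncard_levelSet_boundary_ramK_aniso [CompleteSpace K] [IsDiscreteValuationRing 𝒪[K]] [Finite 𝓀[K]]
    (hρρ : ∀ x, ρ (ρ x) = x) (hvρ : ∀ x, Valued.v (ρ x) = Valued.v x) (hΘρ : ∀ x, Θ (ρ x) = ρ (Θ x))
    (hα1 : Valued.v α ≤ 1) (hα : Valued.v (α - ρ α) = 1) {d t : ℕ} (hD : IsRamifiedQuadraticDatum Θ ϖE d t) (hρϖ : ρ ϖE = ϖE)
    (hΘh : Θ h = h) (hh : h ≠ 0) {q : ℕ} (hq : Nat.card 𝓀[K] = q ^ 2)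
    (hσres : ∀ z : K, ρ z = z → Valued.v z ≤ 1 → Valued.v (Θ z - z) < 1) (hram : Valued.v (α - Θ α) < 1)
    (haniso : ¬ ∃ x : K, x ≠ 0 ∧ h * Θ x * x + ρ (h * Θ x * x) = 0)
    (hd2 : 2 ≤ d) {j a : ℕ} (ha : 1 ≤ a) (hbdry : j + 2 = a + 2 * d) :
    (levelSet ρ Θ α ϖE h j a).ncard = q ^ (j - d + 1) := by
  rw [ncard_levelSet_ramK_aniso_of_frame hρρ hvρ hΘρ hα1 hα hD hρϖ hΘh hh hq hσres hram haniso j a,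
    if_neg (by omega), if_neg (by omega), if_neg (by omega), if_neg (by omega), if_neg (by omega), if_pos (by omega)]

/-- **FAR ROWS, HYPERBOLIC LITERAL, TYPE RamK**: `a ≥ 1`, `a + 2d ≤ j`, `j ≡ a (2)` ⇒ `#levelSet(j, a) = 2(q − 1)·q^{j − 1 − (j−a)∕2}`.  At q = 2, `a = m∕2`, `j = a + c`: the lit₂ TOWER cell
`T_c` has `2·q^{a + c∕2 − 1}` lattices × weight `q^a` = `2^{ρ₁₃}·2^{c∕2}` (64, 128 at key (12,4)). [cite: Flicker1998UnitaryFL, Prop. 7 p. 84] [cite: Serre1979, Ch. V §3 Prop. 5, Cor. 2–3 pp. 84–86] -/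
theorem ncard_levelSet_far_ramK_hyper [CompleteSpace K] [IsDiscreteValuationRing 𝒪[K]] [Finite 𝓀[K]]
    (hρρ : ∀ x, ρ (ρ x) = x) (hvρ : ∀ x, Valued.v (ρ x) = Valued.v x) (hΘρ : ∀ x, Θ (ρ x) = ρ (Θ x))
    (hα1 : Valued.v α ≤ 1) (hα : Valued.v (α - ρ α) = 1) {d t : ℕ} (hD : IsRamifiedQuadraticDatum Θ ϖE d t) (hρϖ : ρ ϖE = ϖE)
    (hΘh : Θ h = h) (hh : h ≠ 0) {q : ℕ} (hq : Nat.card 𝓀[K] = q ^ 2)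
    (hσres : ∀ z : K, ρ z = z → Valued.v z ≤ 1 → Valued.v (Θ z - z) < 1) (hram : Valued.v (α - Θ α) < 1)
    (hhyper : ∃ x : K, x ≠ 0 ∧ h * Θ x * x + ρ (h * Θ x * x) = 0)
    {j a : ℕ} (ha : 1 ≤ a) (hfar : a + 2 * d ≤ j) (hpar : (j - a) % 2 = 0) :
    (levelSet ρ Θ α ϖE h j a).ncard = 2 * (q - 1) * q ^ (j - 1 - (j - a) / 2) := by
  have hd : 1 ≤ d := hD.2.2.2.2.2.1
  rw [ncard_levelSet_ramK_hyper_of_frame hρρ hvρ hΘρ hα1 hα hD hρϖ hΘh hh hq hσres hram hhyper j a,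
    if_neg (by omega), if_neg (by omega), if_neg (by omega), if_neg (by omega), if_neg (by omega), if_neg (by omega)]

/-- **FAR ROWS, ANISOTROPIC LITERAL, TYPE RamK**: `a ≥ 1`, `a + 2d ≤ j`, `j ≡ a (2)` ⇒ `#levelSet(j, a) = 0` (the refuter's «lit₁ = {D, S₁}»: no tower on the anisotropic literal).
[cite: Flicker1998UnitaryFL, Prop. 7 p. 84] [cite: Serre1979, Ch. V §3 Prop. 5, Cor. 2–3 pp. 84–86] -/
theorem ncard_levelSet_far_ramK_aniso [CompleteSpace K] [IsDiscreteValuationRing 𝒪[K]] [Finite 𝓀[K]]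
    (hρρ : ∀ x, ρ (ρ x) = x) (hvρ : ∀ x, Valued.v (ρ x) = Valued.v x) (hΘρ : ∀ x, Θ (ρ x) = ρ (Θ x))
    (hα1 : Valued.v α ≤ 1) (hα : Valued.v (α - ρ α) = 1) {d t : ℕ} (hD : IsRamifiedQuadraticDatum Θ ϖE d t) (hρϖ : ρ ϖE = ϖE)
    (hΘh : Θ h = h) (hh : h ≠ 0) {q : ℕ} (hq : Nat.card 𝓀[K] = q ^ 2)
    (hσres : ∀ z : K, ρ z = z → Valued.v z ≤ 1 → Valued.v (Θ z - z) < 1) (hram : Valued.v (α - Θ α) < 1)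
    (haniso : ¬ ∃ x : K, x ≠ 0 ∧ h * Θ x * x + ρ (h * Θ x * x) = 0)
    {j a : ℕ} (ha : 1 ≤ a) (hfar : a + 2 * d ≤ j) (hpar : (j - a) % 2 = 0) :
    (levelSet ρ Θ α ϖE h j a).ncard = 0 := by
  have hd : 1 ≤ d := hD.2.2.2.2.2.1
  rw [ncard_levelSet_ramK_aniso_of_frame hρρ hvρ hΘρ hα1 hα hD hρϖ hΘh hh hq hσres hram haniso j a,
    if_neg (by omega), if_neg (by omega), if_neg (by omega), if_neg (by omega), if_neg (by omega), if_neg (by omega)]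

/-- **NEAR ROWS, EITHER LITERAL, TYPE RamK**: `a ≥ 1`, `a + 2 ≤ j`, `j + 2 < a + 2d`, `j ≡ a (2)` ⇒ `#levelSet(j, a) = (q − 1)·q^{j − 1 − (j−a)∕2}` for every Θ-fixed `h ≠ 0` (the ★ (S3) and
★ (S4) rows coincide below the boundary). [cite: Flicker1998UnitaryFL, Prop. 7 p. 84] [cite: Serre1979, Ch. V §3 Prop. 5, Cor. 2–3 pp. 84–86] -/
theorem ncard_levelSet_near_ramK [CompleteSpace K] [IsDiscreteValuationRing 𝒪[K]] [Finite 𝓀[K]]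
    (hρρ : ∀ x, ρ (ρ x) = x) (hvρ : ∀ x, Valued.v (ρ x) = Valued.v x) (hΘρ : ∀ x, Θ (ρ x) = ρ (Θ x))
    (hα1 : Valued.v α ≤ 1) (hα : Valued.v (α - ρ α) = 1) {d t : ℕ} (hD : IsRamifiedQuadraticDatum Θ ϖE d t) (hρϖ : ρ ϖE = ϖE)
    (hΘh : Θ h = h) (hh : h ≠ 0) {q : ℕ} (hq : Nat.card 𝓀[K] = q ^ 2)
    (hσres : ∀ z : K, ρ z = z → Valued.v z ≤ 1 → Valued.v (Θ z - z) < 1) (hram : Valued.v (α - Θ α) < 1)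
    {j a : ℕ} (ha : 1 ≤ a) (hc : a + 2 ≤ j) (hnear : j + 2 < a + 2 * d) (hpar : (j - a) % 2 = 0) :
    (levelSet ρ Θ α ϖE h j a).ncard = (q - 1) * q ^ (j - 1 - (j - a) / 2) := by
  by_cases hiso : ∃ x : K, x ≠ 0 ∧ h * Θ x * x + ρ (h * Θ x * x) = 0
  · rw [ncard_levelSet_ramK_hyper_of_frame hρρ hvρ hΘρ hα1 hα hD hρϖ hΘh hh hq hσres hram hiso j a,
      if_neg (by omega), if_neg (by omega), if_neg (by omega), if_neg (by omega), if_pos (by omega)]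
  · rw [ncard_levelSet_ramK_aniso_of_frame hρρ hvρ hΘρ hα1 hα hD hρϖ hΘh hh hq hσres hram hiso j a,
      if_neg (by omega), if_neg (by omega), if_neg (by omega), if_neg (by omega), if_pos (by omega)]

/-! ## §3 The `levelSetDep` forms with the tokens (`|μ| = exp(−m)`, `|μ − ρμ| = exp(−jλ)`; low cells `2a ≤ m`, `j + a ≤ jλ`) -/

/-- **BOUNDARY CELL, HYPERBOLIC, WITH TOKENS**: `#levelSetDep(j, a; μ) = (q − 2)·q^{j−d}` (`j + 2 = a + 2d`, `1 ≤ a`, `2a ≤ m`, `j + a ≤ jλ`, `d ≥ 2`).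
[cite: Flicker1998UnitaryFL, Prop. 7 p. 84] [cite: Kottwitz1986BaseChangeUnits, §1 pp. 240–241] -/
theorem ncard_levelSetDep_boundary_ramK_hyper [CompleteSpace K] [IsDiscreteValuationRing 𝒪[K]] [Finite 𝓀[K]]
    (hρρ : ∀ x, ρ (ρ x) = x) (hvρ : ∀ x, Valued.v (ρ x) = Valued.v x) (hΘρ : ∀ x, Θ (ρ x) = ρ (Θ x))
    (hα1 : Valued.v α ≤ 1) (hα : Valued.v (α - ρ α) = 1) {d t : ℕ} (hD : IsRamifiedQuadraticDatum Θ ϖE d t) (hρϖ : ρ ϖE = ϖE)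
    (hΘh : Θ h = h) (hh : h ≠ 0) {q : ℕ} (hq : Nat.card 𝓀[K] = q ^ 2)
    (hσres : ∀ z : K, ρ z = z → Valued.v z ≤ 1 → Valued.v (Θ z - z) < 1) (hram : Valued.v (α - Θ α) < 1)
    (hhyper : ∃ x : K, x ≠ 0 ∧ h * Θ x * x + ρ (h * Θ x * x) = 0)
    (hd2 : 2 ≤ d) {μ : K} {m jl : ℕ} (hm : Valued.v μ = exp (-(m : ℤ))) (hjl : Valued.v (μ - ρ μ) = exp (-(jl : ℤ)))
    {j a : ℕ} (ha : 1 ≤ a) (h2a : 2 * a ≤ m) (hja : j + a ≤ jl) (hbdry : j + 2 = a + 2 * d) :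
    (levelSetDep ρ Θ α ϖE h j a μ).ncard = (q - 2) * q ^ (j - d) := by
  rw [ncard_levelSetDep_eq_of_add_le hρρ hvρ hD.1 hΘρ hD.2.1 hα1 hα hρϖ hD.2.2.1 hh hm hjl ha h2a hja]
  exact ncard_levelSet_boundary_ramK_hyper hρρ hvρ hΘρ hα1 hα hD hρϖ hΘh hh hq hσres hram hhyper hd2 ha hbdry

/-- **BOUNDARY CELL, ANISOTROPIC, WITH TOKENS**: `#levelSetDep(j, a; μ) = q^{j−d+1}` (`j + 2 = a + 2d`, `1 ≤ a`, `2a ≤ m`, `j + a ≤ jλ`, `d ≥ 2`) — the refuter's `|S₁|∕q^a`.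
[cite: Flicker1998UnitaryFL, Prop. 7 p. 84] [cite: Kottwitz1986BaseChangeUnits, §1 pp. 240–241] -/
theorem ncard_levelSetDep_boundary_ramK_aniso [CompleteSpace K] [IsDiscreteValuationRing 𝒪[K]] [Finite 𝓀[K]]
    (hρρ : ∀ x, ρ (ρ x) = x) (hvρ : ∀ x, Valued.v (ρ x) = Valued.v x) (hΘρ : ∀ x, Θ (ρ x) = ρ (Θ x))
    (hα1 : Valued.v α ≤ 1) (hα : Valued.v (α - ρ α) = 1) {d t : ℕ} (hD : IsRamifiedQuadraticDatum Θ ϖE d t) (hρϖ : ρ ϖE = ϖE)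
    (hΘh : Θ h = h) (hh : h ≠ 0) {q : ℕ} (hq : Nat.card 𝓀[K] = q ^ 2)
    (hσres : ∀ z : K, ρ z = z → Valued.v z ≤ 1 → Valued.v (Θ z - z) < 1) (hram : Valued.v (α - Θ α) < 1)
    (haniso : ¬ ∃ x : K, x ≠ 0 ∧ h * Θ x * x + ρ (h * Θ x * x) = 0)
    (hd2 : 2 ≤ d) {μ : K} {m jl : ℕ} (hm : Valued.v μ = exp (-(m : ℤ))) (hjl : Valued.v (μ - ρ μ) = exp (-(jl : ℤ)))
    {j a : ℕ} (ha : 1 ≤ a) (h2a : 2 * a ≤ m) (hja : j + a ≤ jl) (hbdry : j + 2 = a + 2 * d) :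
    (levelSetDep ρ Θ α ϖE h j a μ).ncard = q ^ (j - d + 1) := by
  rw [ncard_levelSetDep_eq_of_add_le hρρ hvρ hD.1 hΘρ hD.2.1 hα1 hα hρϖ hD.2.2.1 hh hm hjl ha h2a hja]
  exact ncard_levelSet_boundary_ramK_aniso hρρ hvρ hΘρ hα1 hα hD hρϖ hΘh hh hq hσres hram haniso hd2 ha hbdry

/-- **FAR CELL, HYPERBOLIC, WITH TOKENS** (the lit₂ tower cells `c ≤ δ`): `#levelSetDep(j, a; μ) = 2(q − 1)·q^{j − 1 − (j−a)∕2}` (`1 ≤ a`, `2a ≤ m`, `j + a ≤ jλ`, `a + 2d ≤ j`, `j ≡ a (2)`).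
[cite: Flicker1998UnitaryFL, Prop. 7 p. 84] [cite: Kottwitz1986BaseChangeUnits, §1 pp. 240–241] -/
theorem ncard_levelSetDep_far_ramK_hyper [CompleteSpace K] [IsDiscreteValuationRing 𝒪[K]] [Finite 𝓀[K]]
    (hρρ : ∀ x, ρ (ρ x) = x) (hvρ : ∀ x, Valued.v (ρ x) = Valued.v x) (hΘρ : ∀ x, Θ (ρ x) = ρ (Θ x))
    (hα1 : Valued.v α ≤ 1) (hα : Valued.v (α - ρ α) = 1) {d t : ℕ} (hD : IsRamifiedQuadraticDatum Θ ϖE d t) (hρϖ : ρ ϖE = ϖE)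
    (hΘh : Θ h = h) (hh : h ≠ 0) {q : ℕ} (hq : Nat.card 𝓀[K] = q ^ 2)
    (hσres : ∀ z : K, ρ z = z → Valued.v z ≤ 1 → Valued.v (Θ z - z) < 1) (hram : Valued.v (α - Θ α) < 1)
    (hhyper : ∃ x : K, x ≠ 0 ∧ h * Θ x * x + ρ (h * Θ x * x) = 0)
    {μ : K} {m jl : ℕ} (hm : Valued.v μ = exp (-(m : ℤ))) (hjl : Valued.v (μ - ρ μ) = exp (-(jl : ℤ)))
    {j a : ℕ} (ha : 1 ≤ a) (h2a : 2 * a ≤ m) (hja : j + a ≤ jl) (hfar : a + 2 * d ≤ j) (hpar : (j - a) % 2 = 0) :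
    (levelSetDep ρ Θ α ϖE h j a μ).ncard = 2 * (q - 1) * q ^ (j - 1 - (j - a) / 2) := by
  rw [ncard_levelSetDep_eq_of_add_le hρρ hvρ hD.1 hΘρ hD.2.1 hα1 hα hρϖ hD.2.2.1 hh hm hjl ha h2a hja]
  exact ncard_levelSet_far_ramK_hyper hρρ hvρ hΘρ hα1 hα hD hρϖ hΘh hh hq hσres hram hhyper ha hfar hpar

/-- **FAR CELL, ANISOTROPIC, WITH TOKENS**: `#levelSetDep(j, a; μ) = 0` (`1 ≤ a`, `2a ≤ m`, `j + a ≤ jλ`, `a + 2d ≤ j`, `j ≡ a (2)`).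
[cite: Flicker1998UnitaryFL, Prop. 7 p. 84] [cite: Kottwitz1986BaseChangeUnits, §1 pp. 240–241] -/
theorem ncard_levelSetDep_far_ramK_aniso [CompleteSpace K] [IsDiscreteValuationRing 𝒪[K]] [Finite 𝓀[K]]
    (hρρ : ∀ x, ρ (ρ x) = x) (hvρ : ∀ x, Valued.v (ρ x) = Valued.v x) (hΘρ : ∀ x, Θ (ρ x) = ρ (Θ x))
    (hα1 : Valued.v α ≤ 1) (hα : Valued.v (α - ρ α) = 1) {d t : ℕ} (hD : IsRamifiedQuadraticDatum Θ ϖE d t) (hρϖ : ρ ϖE = ϖE)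
    (hΘh : Θ h = h) (hh : h ≠ 0) {q : ℕ} (hq : Nat.card 𝓀[K] = q ^ 2)
    (hσres : ∀ z : K, ρ z = z → Valued.v z ≤ 1 → Valued.v (Θ z - z) < 1) (hram : Valued.v (α - Θ α) < 1)
    (haniso : ¬ ∃ x : K, x ≠ 0 ∧ h * Θ x * x + ρ (h * Θ x * x) = 0)
    {μ : K} {m jl : ℕ} (hm : Valued.v μ = exp (-(m : ℤ))) (hjl : Valued.v (μ - ρ μ) = exp (-(jl : ℤ)))
    {j a : ℕ} (ha : 1 ≤ a) (h2a : 2 * a ≤ m) (hja : j + a ≤ jl) (hfar : a + 2 * d ≤ j) (hpar : (j - a) % 2 = 0) :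
    (levelSetDep ρ Θ α ϖE h j a μ).ncard = 0 := by
  rw [ncard_levelSetDep_eq_of_add_le hρρ hvρ hD.1 hΘρ hD.2.1 hα1 hα hρϖ hD.2.2.1 hh hm hjl ha h2a hja]
  exact ncard_levelSet_far_ramK_aniso hρρ hvρ hΘρ hα1 hα hD hρϖ hΘh hh hq hσres hram haniso ha hfar hpar

/-- **NEAR CELL, EITHER LITERAL, WITH TOKENS**: `#levelSetDep(j, a; μ) = (q − 1)·q^{j − 1 − (j−a)∕2}` (`1 ≤ a`, `2a ≤ m`, `j + a ≤ jλ`, `a + 2 ≤ j`, `j + 2 < a + 2d`, `j ≡ a (2)`).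
[cite: Flicker1998UnitaryFL, Prop. 7 p. 84] [cite: Kottwitz1986BaseChangeUnits, §1 pp. 240–241] -/
theorem ncard_levelSetDep_near_ramK [CompleteSpace K] [IsDiscreteValuationRing 𝒪[K]] [Finite 𝓀[K]]
    (hρρ : ∀ x, ρ (ρ x) = x) (hvρ : ∀ x, Valued.v (ρ x) = Valued.v x) (hΘρ : ∀ x, Θ (ρ x) = ρ (Θ x))
    (hα1 : Valued.v α ≤ 1) (hα : Valued.v (α - ρ α) = 1) {d t : ℕ} (hD : IsRamifiedQuadraticDatum Θ ϖE d t) (hρϖ : ρ ϖE = ϖE)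
    (hΘh : Θ h = h) (hh : h ≠ 0) {q : ℕ} (hq : Nat.card 𝓀[K] = q ^ 2)
    (hσres : ∀ z : K, ρ z = z → Valued.v z ≤ 1 → Valued.v (Θ z - z) < 1) (hram : Valued.v (α - Θ α) < 1)
    {μ : K} {m jl : ℕ} (hm : Valued.v μ = exp (-(m : ℤ))) (hjl : Valued.v (μ - ρ μ) = exp (-(jl : ℤ)))
    {j a : ℕ} (ha : 1 ≤ a) (h2a : 2 * a ≤ m) (hja : j + a ≤ jl) (hc : a + 2 ≤ j) (hnear : j + 2 < a + 2 * d) (hpar : (j - a) % 2 = 0) :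
    (levelSetDep ρ Θ α ϖE h j a μ).ncard = (q - 1) * q ^ (j - 1 - (j - a) / 2) := by
  rw [ncard_levelSetDep_eq_of_add_le hρρ hvρ hD.1 hΘρ hD.2.1 hα1 hα hρϖ hD.2.2.1 hh hm hjl ha h2a hja]
  exact ncard_levelSet_near_ramK hρρ hvρ hΘρ hα1 hα hD hρϖ hΘh hh hq hσres hram ha hc hnear hpar

end RamK

/-! ## §4 The (β) cone frame: the weighted size of a low cell is `q_E^a · #levelSet(j, a)` -/

section Cone

variable {E : Type} {M : Type*} [Field E] [Valued E ℤᵐ⁰] [Field M] [Valued M ℤᵐ⁰] {ρ Θ : M →+* M} {α : M}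

/-- **WEIGHTED SIZE OF A LOW CONE CELL** (lane-agnostic: any `M∕E`-unramified line model, `|jE ϖ| = exp(−1)`).  Frame of ★ `finsum_levelSetDep_weight_eq_pow_mul_ncard` (★ (C1) §2 +
the E-side wild datum + a flip unit `z`; weight letter `hf` VERBATIM) plus `|α − ρα| = 1`, `|jE ϖ| = exp(−1)` and the tokens `|lam − jE u| = exp(−m)`,
`|(lam − jE u) − ρ(lam − jE u)| = exp(−jλ)`.  THEN for `1 ≤ a`, `2a ≤ m`, `j + a ≤ jλ`, `lam ∈ 𝒪_j`:
`Σᶠ_{Λ ∈ levelSetDep(j, a; lam − jE u)} f a j Λ = #𝓀[E]^a · #levelSet(j, a)` — ★ cone weight `q_E^a · #cell` with `cell = levelSet(j, a)` by §1; rewrite `#levelSet(j, a)` with §2 in the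
RamK lane (boundary ∕ far ∕ near) or with ★ p861334 on the diagonal. [cite: Kottwitz1986BaseChangeUnits, §1 pp. 240–241] [cite: Serre1979, Ch. V §3 Prop. 5, Cor. 2–3 pp. 84–86]
[cite: Jacobowitz1962, §4] -/
theorem finsum_levelSetDep_weight_eq_pow_mul_ncard_levelSet_of_add_le [CompleteSpace E] [IsDiscreteValuationRing 𝒪[E]] [Finite 𝓀[E]]
    (σ : E →+* E) (hσ : ∀ a, σ (σ a) = a) (hvσ : ∀ a, Valued.v (σ a) = Valued.v a)
    {ϖ : E} (hϖ : Valued.v ϖ = WithZero.exp (-1 : ℤ)) {d t : ℕ} (hD : IsRamifiedQuadraticDatum σ ϖ d t) (h2v : Valued.v (2 : E) < 1)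
    {H₂ : Matrix (Fin 2) (Fin 2) E} (hH₂σ : (H₂.map σ)ᵀ = H₂) {hW : E} (hhW : Valued.v hW = 1) (hhWσ : σ hW = hW) (jE : E →+* M)
    (hρρ : ∀ x, ρ (ρ x) = x) (hvρ : ∀ x, Valued.v (ρ x) = Valued.v x) (hα : ρ α ≠ α) (hα1 : Valued.v α ≤ 1)
    (hint : ∀ z : M, Valued.v z ≤ 1 → Valued.v ((z - ρ z) / (α - ρ α)) ≤ 1)
    (hΘΘ : ∀ x, Θ (Θ x) = x) (hΘρ : ∀ x, Θ (ρ x) = ρ (Θ x)) (hvΘ : ∀ x, Valued.v (Θ x) = Valued.v x) (hΘj : ∀ x, Θ (jE x) = jE (σ x))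
    (hjv : ∀ c, Valued.v (jE c) ≤ 1 ↔ Valued.v c ≤ 1) (hjfix : ∀ z, ρ z = z ↔ ∃ c, jE c = z)
    (hjpow : ∀ (t : E) (n : ℤ), Valued.v (jE t) = Valued.v (jE ϖ) ^ n ↔ Valued.v t = Valued.v ϖ ^ n)
    (hϖmax : ∀ t : M, ρ t = t → Valued.v t < 1 → Valued.v t ≤ Valued.v (jE ϖ))
    (φ : (Fin 2 → E) →+ M) (hφs : ∀ (c : E) (x : Fin 2 → E), φ (c • x) = jE c * φ x) (hφi : Function.Injective φ) (hφo : Function.Surjective φ)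
    {γ₂ : GL (Fin 2) E} {lam h : M} (hφγ : ∀ x, φ ((γ₂ : Matrix (Fin 2) (Fin 2) E).mulVec x) = lam * φ x) (hlam : Valued.v lam = 1)
    (hΘh : Θ h = h) (hh : h ≠ 0) (hform : ∀ x y, jE (pairing σ H₂ x y) = h * Θ (φ x) * φ y + ρ (h * Θ (φ x) * φ y))
    (z : M) (hz1 : Valued.v z = 1) (ξ : E) (hzξ : z * Θ z = jE ξ) (hσξ : σ ξ = ξ) (hξN : ¬ ∃ e : E, e * σ e = ξ)
    (u : E)
    (f : ℕ → ℕ → AddSubgroup M → ℕ)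
    (hf : ∀ (b j : ℕ) (Λ : AddSubgroup M) (x₀ : M) (r : E), 1 ≤ b → x₀ ≠ 0 →
      (∀ x, x ∈ Λ ↔ ∃ z, IsOrd ρ α (jE ϖ ^ j) z ∧ x = x₀ * z) →
      IsOrd ρ α (jE ϖ ^ j) (dualGen ρ Θ α (jE ϖ ^ j) h x₀) → ¬ IsOrd ρ α (jE ϖ ^ j) (dualGen ρ Θ α (jE ϖ ^ j) h x₀ / jE ϖ) →
      Valued.v (dualGen ρ Θ α (jE ϖ ^ j) h x₀) = Valued.v (jE ϖ) ^ b →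
      (∀ b', (∀ x ∈ Λ, Valued.v (h * Θ x * b' + ρ (h * Θ x * b')) ≤ 1) → (lam - jE u) * b' ∈ Λ) →
      IsOrd ρ α (jE ϖ ^ j) lam → jE r = glueUnit ρ Θ α (jE ϖ ^ j) h (jE ϖ) (jE hW) x₀ b →
      f b j Λ = Nat.card {x : 𝒪[E] ⧸ 𝓂[E] ^ (2 * b) // ∃ u' : 𝒪[E], Ideal.Quotient.mk (𝓂[E] ^ (2 * b)) u' = x ∧
        Valued.v ((u' : E) * σ u' - r) ≤ Valued.v (ϖ ^ (2 * b))})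
    -- the two extra M-side letters and the tokens
    (hαρ1 : Valued.v (α - ρ α) = 1) (hϖE : Valued.v (jE ϖ) = exp (-1 : ℤ))
    {m jl : ℕ} (hm : Valued.v (lam - jE u) = exp (-(m : ℤ))) (hjl : Valued.v ((lam - jE u) - ρ (lam - jE u)) = exp (-(jl : ℤ)))
    {j a : ℕ} (ha : 1 ≤ a) (h2a : 2 * a ≤ m) (hja : j + a ≤ jl) (hlamj : IsOrd ρ α (jE ϖ ^ j) lam) (hfin : (levelSet ρ Θ α (jE ϖ) h j a).Finite) :
    ∑ᶠ Λ ∈ levelSetDep ρ Θ α (jE ϖ) h j a (lam - jE u), f a j Λ = Nat.card 𝓀[E] ^ a * (levelSet ρ Θ α (jE ϖ) h j a).ncard := by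
  have hρϖ : ρ (jE ϖ) = jE ϖ := (hjfix (jE ϖ)).2 ⟨ϖ, rfl⟩
  rw [finsum_levelSetDep_weight_eq_pow_mul_ncard σ hσ hvσ hϖ hD h2v hH₂σ hhW hhWσ jE hρρ hvρ hα hα1 hint hΘΘ hΘρ hvΘ hΘj hjv hjfix hjpow hϖmax
      φ hφs hφi hφo hφγ hlam hΘh hh hform z hz1 ξ hzξ hσξ hξN u ha hlamj hfin f hf,
    ncard_levelSetDep_eq_of_add_le hρρ hvρ hΘΘ hΘρ hvΘ hα1 hαρ1 hρϖ hϖE hh hm hjl ha h2a hja]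

end Cone

end Summit.HodgeConjecture.HodgeConjecture.Cruxes.H413.F0P3cDyRamConeCellLedgerSizes

end
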